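import Mathlib
import Summits.ValiantsHypothesis.ValiantsHypothesis.Theorems.GrenetZeonTwoDimCoefficientsScalingPerturbedRay
import Summits.ValiantsHypothesis.ValiantsHypothesis.Theorems.GrenetZeonTwoDimCoefficientsScalingGenericNumerator
import Summits.ValiantsHypothesis.ValiantsHypothesis.Theorems.GrenetZeonTwoDimCoefficientsScalingRaySeparable
import Summits.ValiantsHypothesis.ValiantsHypothesis.Theorems.GrenetZeonTwoDimCoefficientsScalingCompanionDegree

/-!
# Crux `GrenetZeon.TwoDimCoefficients` (stmt-ValiantsHypothesis-8062), stub `stub_dualUnipotent`: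
# scaling-closure — ★★★ `n³ ≤ 2m²` for EVERY index-`n` unipotent dual representation (EIGHTEENTH-HAND.md: L1′ dissolved)

The 17th hand proved the 3/2 rung `n³ ≤ 2m²` (the bound of crux `DualUnipotentThreeHalves`, stmt-24318, constant `2`)
for index-`n` pencils whose shadow is squarefree, and left the repeated-factor case (residual L1′) open as an analytic
problem.  The numerator-perturbation argument removes the hypothesis altogether:

* run the per-free engine (✓ `rank_hess0_top_le_of_perturbedRay`) on the NON-representation `(A, θ·B + C)`, whose
  top first companion is `θβ⁻¹·per_n + q`; the direction `C` is chosen (✓ `exists_numerator_direction`) so that for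
  infinitely many `θ` the ray polynomial at a Mignon–Ressayre point `z₀` of maximal `rank N(z₀)^{n−1} = r` has `r`
  distinct simple roots; hence `rank(θβ⁻¹·Hess per + Hess q)(z₀) ≤ 2m·r` for infinitely many `θ`;
* SPECIALISE (✓ `rank_map_eval_le_of_infinite` on `s ↦ β⁻¹Hess per + s·Hess q`, `s = θ⁻¹`): `n² = rank Hess per(z₀) ≤ 2m·r`;
* `r·n ≤ m` because the top companion `[D_r]_{rn}` of the perturbed pair is non-zero and `deg D_r ≤ m`.

* ★★★ `cube_le_two_mul_sq_of_index` — every index-`n` unipotent dual representation of `per_n`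
  (`A = A₀(1 − N)`, `N` linear, `Nⁿ = 0`, `B` affine, `det A = c ≠ 0`, `per_n = α·c + β·tr(adj A·B)`, `n ≥ 3`)
  satisfies `n³ ≤ 2m²`.  No squarefreeness, no certificate: the residual L1′ of SEVENTEENTH-HAND.md is gone.

What remains between this and the DECL `DualUnipotentThreeHalves` (stmt-24318) is R6 only: the index-`n`
normalisation (`Nⁿ = 0`) of a general unipotent pencil.

HONEST FRAMING: an unconditional 3/2 rung on the index-`n` class; the stub `DualUnipotentBound` (n² ≤ C·m), crux 8062,
the 24318 decl for general pencils, and `VP ≠ VNP` remain open.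

References: T. Mignon, N. Ressayre, Int. Math. Res. Not. 2004:79, Thm. 1.1 (via the tree); folklore.
-/

-- single-conjunct layout `Summits/ValiantsHypothesis/ValiantsHypothesis`: the duplicated namespace
-- component is mandated by the tree.
set_option linter.dupNamespace false
set_option autoImplicit false

noncomputable section

namespace Summit.ValiantsHypothesis.ValiantsHypothesis.Theorems.GrenetZeonTwoDimCoefficients.ScalingClosure

open MvPolynomial Matrix
open Literature.Computability.AlgebraicComplexity
open Summit.ValiantsHypothesis.ValiantsHypothesis.Cruxes.TwoDimCoefficients.DimTwoCases

section IndexThreeHalves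

/-- A non-zero complex polynomial in several variables has a non-root. [folklore] -/
theorem exists_eval_ne_zero_of_ne_zero {σ : Type*} (p : MvPolynomial σ ℂ) (hp : p ≠ 0) :
    ∃ z : σ → ℂ, eval z p ≠ 0 := by
  by_contra hall
  push Not at hall
  exact hp (MvPolynomial.funext fun z => by rw [hall z, map_zero])

/-- ★★★ **`n³ ≤ 2m²` for every index-`n` unipotent dual representation of `per_n`** (`n = k + 3`).
[cite: MignonRessayre2004, Thm. 1.1 — via the tree; folklore] -/
theorem cube_le_two_mul_sq_of_index {k m : ℕ} (A B : AffMat (k + 3) m) (hA : IsAffine A) (hB : IsAffine B)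
    (α β c : ℂ) (hc : c ≠ 0) (hβ : β ≠ 0) (hdet : A.det = MvPolynomial.C c)
    (hper : perPoly (Fin (k + 3)) ℂ =
      MvPolynomial.C α * A.det + MvPolynomial.C β * (A.adjugate * B).trace)
    (A₀ P₀ : Matrix (Fin m) (Fin m) ℂ) (hP₀ : A₀ * P₀ = 1) (N : AffMat (k + 3) m)
    (hN : ∀ i j, (N i j).IsHomogeneous 1) (hNn : N ^ (k + 3) = 0) (hAN : A = A₀.map MvPolynomial.C * (1 - N)) :
    (k + 3) ^ 3 ≤ 2 * m ^ 2 := by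
  classical
  have hu : IsUnit A.det := by rw [hdet]; exact (isUnit_iff_ne_zero.mpr hc).map MvPolynomial.C
  have hP₀A₀ : P₀ * A₀ = 1 := mul_eq_one_comm.mp hP₀
  -- Step 1: the maximal rank `r` of `N(z)^{n-1}`
  set r : ℕ := Nat.findGreatest (fun j => ∃ z : Fin (k + 3) × Fin (k + 3) → ℂ,
    j ≤ ((N.map (eval z)) ^ (k + 3 - 1)).rank) m with hrdef
  have hr_spec : ∃ z₁ : Fin (k + 3) × Fin (k + 3) → ℂ, r ≤ ((N.map (eval z₁)) ^ (k + 3 - 1)).rank :=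
    Nat.findGreatest_spec (P := fun j => ∃ z : Fin (k + 3) × Fin (k + 3) → ℂ,
      j ≤ ((N.map (eval z)) ^ (k + 3 - 1)).rank) (Nat.zero_le m) ⟨0, Nat.zero_le _⟩
  have hr_max : ∀ z : Fin (k + 3) × Fin (k + 3) → ℂ, ((N.map (eval z)) ^ (k + 3 - 1)).rank ≤ r := fun z =>
    Nat.le_findGreatest (Matrix.rank_le_width _) ⟨z, le_rfl⟩
  have hrm : r ≤ m := Nat.findGreatest_le m
  -- the companions of `(A, B)`; `r ≥ 1` since `[D_1]_n = β⁻¹ per_n ≠ 0`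
  obtain ⟨D, hD⟩ : ∃ D : ℕ → MvPolynomial (Fin (k + 3) × Fin (k + 3)) ℂ, ∀ j, D j =
      (det ((Polynomial.X : Polynomial (MvPolynomial (Fin (k + 3) × Fin (k + 3)) ℂ)) •
        B.map Polynomial.C + A.map Polynomial.C)).coeff j := ⟨_, fun _ => rfl⟩
  have hper0 : MvPolynomial.C β⁻¹ * perPoly (Fin (k + 3)) ℂ ≠ 0 :=
    mul_ne_zero ((map_ne_zero_iff _ (MvPolynomial.C_injective _ _)).mpr (inv_ne_zero hβ))
      (perPoly_ne_zero (Fin (k + 3)) ℂ)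
  have hr1 : 1 ≤ r := by
    by_contra h0
    have hz := topCompanion_eq_zero_of_rank_lt (n := k + 3) (by omega) A₀ P₀ hP₀ N hN hNn A hAN c hc hdet B hB
      hr_max D hD (k := 1) (by omega)
    rw [one_mul, hD 1, homogeneousComponent_coeff_det_one (by omega) A B α β c hc hβ hdet hper] at hz
    exact hper0 hz
  obtain ⟨z₁, hz₁⟩ := hr_spec
  obtain ⟨r', hr'⟩ : ∃ r', r = r' + 1 := ⟨r - 1, by omega⟩
  -- Step 2: a non-zero `r`-minor of `N^{n-1}` and the Hessian determinant of `per`; the point `z₀`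
  obtain ⟨ρ, κ, hρκ⟩ := (succ_le_rank_iff_exists_det_submatrix_ne_zero ((N.map (eval z₁)) ^ (k + 3 - 1)) r').mp
    (by rw [← hr']; exact hz₁)
  set μ : MvPolynomial (Fin (k + 3) × Fin (k + 3)) ℂ := ((N ^ (k + 3 - 1)).submatrix ρ κ).det with hμ
  have hμeval : ∀ z : Fin (k + 3) × Fin (k + 3) → ℂ,
      eval z μ = (((N.map (eval z)) ^ (k + 3 - 1)).submatrix ρ κ).det := by
    intro z
    rw [hμ, RingHom.map_det, RingHom.mapMatrix_apply, ← Matrix.submatrix_map, Matrix.map_pow]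
  have hμ0 : μ ≠ 0 := fun h => hρκ (by rw [← hμeval, h, map_zero])
  set H : MvPolynomial (Fin (k + 3) × Fin (k + 3)) ℂ :=
    (Matrix.of fun s t : Fin (k + 3) × Fin (k + 3) => pderiv s (pderiv t (perPoly (Fin (k + 3)) ℂ))).det with hH
  have hH0 : H ≠ 0 := det_hessianMatrix_perPoly_ne_zero k
  set i₀ : Fin (k + 3) × Fin (k + 3) := (0, 0) with hi₀
  obtain ⟨z₀, hz₀⟩ := exists_eval_ne_zero_of_ne_zero (H * μ * X i₀)
    (mul_ne_zero (mul_ne_zero hH0 hμ0) (X_ne_zero i₀))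
  rw [map_mul, map_mul, MvPolynomial.eval_X] at hz₀
  have hHz : eval z₀ H ≠ 0 := fun h => hz₀ (by rw [h, zero_mul, zero_mul])
  have hμz : eval z₀ μ ≠ 0 := fun h => hz₀ (by rw [h, mul_zero, zero_mul])
  have hz00 : z₀ i₀ ≠ 0 := fun h => hz₀ (by rw [h, mul_zero])
  set N₀ : Matrix (Fin m) (Fin m) ℂ := (N.map (eval z₀)) ^ (k + 3 - 1) with hN₀
  have hN₀r : N₀.rank = r := by
    refine le_antisymm (hr_max z₀) ?_
    rw [hr']
    exact (succ_le_rank_iff_exists_det_submatrix_ne_zero N₀ r').mpr ⟨ρ, κ, by rw [hN₀, ← hμeval]; exact hμz⟩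
  -- Step 3: the numerator direction
  set B1 : AffMat (k + 3) m := Matrix.of fun a b => homogeneousComponent 1 (B a b) with hB1
  set M₀ : Matrix (Fin m) (Fin m) ℂ := P₀ * B1.map (eval z₀) with hM₀
  obtain ⟨K, hK⟩ := exists_numerator_direction N₀ M₀ c hc
  set Cmat : AffMat (k + 3) m :=
    (X i₀ * MvPolynomial.C (z₀ i₀)⁻¹ : MvPolynomial (Fin (k + 3) × Fin (k + 3)) ℂ) • (A₀ * K).map MvPolynomial.C
    with hCmat
  have hCentry : ∀ a b, Cmat a b = X i₀ * MvPolynomial.C ((z₀ i₀)⁻¹ * (A₀ * K) a b) := by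
    intro a b
    rw [hCmat, Matrix.smul_apply, Matrix.map_apply, smul_eq_mul, map_mul, mul_assoc]
  have hChom : ∀ a b, (Cmat a b).IsHomogeneous 1 := fun a b => by
    rw [hCentry]
    simpa using (isHomogeneous_X ℂ i₀).mul (isHomogeneous_C (Fin (k + 3) × Fin (k + 3)) ((z₀ i₀)⁻¹ * (A₀ * K) a b))
  set Bθ : ℂ → AffMat (k + 3) m := fun θ => (MvPolynomial.C θ : MvPolynomial (Fin (k + 3) × Fin (k + 3)) ℂ) • B + Cmat
    with hBθ
  have hBθentry : ∀ θ a b, Bθ θ a b = MvPolynomial.C θ * B a b + Cmat a b := fun θ a b => by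
    rw [hBθ]; simp only [Matrix.add_apply, Matrix.smul_apply, smul_eq_mul]
  have hBθaff : ∀ θ, IsAffine (Bθ θ) := by
    intro θ a b
    rw [hBθentry]
    refine (totalDegree_add _ _).trans (max_le ?_ (hChom a b).totalDegree_le)
    exact (totalDegree_mul _ _).trans (by rw [totalDegree_C, zero_add]; exact hB a b)
  -- linear parts at `z₀`
  have hlin : ∀ θ : ℂ, P₀ * (Matrix.of fun a b => homogeneousComponent 1 (Bθ θ a b)).map (eval z₀) = θ • M₀ + K := by
    intro θ
    have h1 : (Matrix.of fun a b => homogeneousComponent 1 (Bθ θ a b)).map (eval z₀) =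
        θ • B1.map (eval z₀) + A₀ * K := by
      apply Matrix.ext; intro a b
      rw [Matrix.map_apply, Matrix.of_apply, hBθentry, map_add, homogeneousComponent_C_mul,
        homogeneousComponent_eq_self (hChom a b), map_add, map_mul, MvPolynomial.eval_C, hCentry, map_mul,
        MvPolynomial.eval_X, MvPolynomial.eval_C, ← mul_assoc, mul_inv_cancel₀ hz00, one_mul, Matrix.add_apply,
        Matrix.smul_apply, Matrix.map_apply, hB1, Matrix.of_apply, smul_eq_mul]
    rw [h1, Matrix.mul_add, Matrix.mul_smul, ← Matrix.mul_assoc, hP₀A₀, Matrix.one_mul]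
  -- the top first companion of `(A, Bθ)`
  set q : MvPolynomial (Fin (k + 3) × Fin (k + 3)) ℂ := homogeneousComponent (k + 3) ((A.adjugate * Cmat).trace)
    with hq
  have htopB : homogeneousComponent (k + 3) ((A.adjugate * B).trace) = MvPolynomial.C β⁻¹ * perPoly (Fin (k + 3)) ℂ := by
    rw [← coeff_det_one A B hu]
    exact homogeneousComponent_coeff_det_one (by omega) A B α β c hc hβ hdet hper
  have htop1 : ∀ θ : ℂ, homogeneousComponent (k + 3)
      ((det ((Polynomial.X : Polynomial (MvPolynomial (Fin (k + 3) × Fin (k + 3)) ℂ)) •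
        (Bθ θ).map Polynomial.C + A.map Polynomial.C)).coeff 1) =
      MvPolynomial.C θ * (MvPolynomial.C β⁻¹ * perPoly (Fin (k + 3)) ℂ) + q := by
    intro θ
    rw [coeff_det_one A (Bθ θ) hu, hBθ]
    simp only
    rw [Matrix.mul_add, Matrix.mul_smul, Matrix.trace_add, Matrix.trace_smul, smul_eq_mul, map_add,
      homogeneousComponent_C_mul, htopB]
  -- Hessians at `z₀`
  set Hp : Matrix (Fin (k + 3) × Fin (k + 3)) (Fin (k + 3) × Fin (k + 3)) ℂ :=
    hess0 (transl z₀ (MvPolynomial.C β⁻¹ * perPoly (Fin (k + 3)) ℂ)) with hHpdef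
  set Hq : Matrix (Fin (k + 3) × Fin (k + 3)) (Fin (k + 3) × Fin (k + 3)) ℂ := hess0 (transl z₀ q) with hHqdef
  have hHθ : ∀ θ : ℂ, hess0 (transl z₀ (MvPolynomial.C θ * (MvPolynomial.C β⁻¹ * perPoly (Fin (k + 3)) ℂ) + q)) =
      θ • Hp + Hq := by
    intro θ
    rw [map_add, map_add, map_mul, transl_C, hess0_C_mul]
  -- Step 4: the engine for the good parameters
  set S : Set ℂ := {θ : ℂ | ∃ t : Fin N₀.rank → ℂ, Function.Injective t ∧ (∀ i, t i ≠ 0) ∧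
      (∀ i, (Polynomial.C c * (-(N₀ * (θ • M₀ + K))).charpolyRev).eval (t i) = 0) ∧
      (∀ i, (Polynomial.derivative (Polynomial.C c * (-(N₀ * (θ • M₀ + K))).charpolyRev)).eval (t i) ≠ 0) ∧
      (Polynomial.C c * (-(N₀ * (θ • M₀ + K))).charpolyRev).coeff N₀.rank ≠ 0} with hS
  have hSinf : S.Infinite := hK
  have hgood : ∀ θ ∈ S, (θ • Hp + Hq).rank ≤ r * (2 * m) ∧ r * (k + 3) ≤ m := by
    intro θ hθ
    obtain ⟨t, ht, ht0, hroot, hder, hcoeff⟩ := hθ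
    have hRz : Polynomial.C c * (-(N₀ * (θ • M₀ + K))).charpolyRev =
        Polynomial.C c * (-(((N.map (eval z₀)) ^ (k + 3 - 1)) *
          (P₀ * (Matrix.of fun a b => homogeneousComponent 1 (Bθ θ a b)).map (eval z₀)))).charpolyRev := by
      rw [hlin θ]
    constructor
    · have h := rank_hess0_top_le_of_perturbedRay (n := k + 3) (by omega) A₀ P₀ hP₀ N hN hNn A hAN hA c hc hdet
        (Bθ θ) (hBθaff θ) hr1 hrm hr_max z₀ (t ∘ Fin.cast hN₀r.symm)
        (ht.comp (Fin.cast_injective _)) (fun i => ht0 _) _ hRz (fun i => hroot _) (fun i => hder _)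
      rwa [htop1 θ, hHθ θ] at h
    · -- `[D^θ_r]_{rn} ≠ 0` and `deg D^θ_r ≤ m`
      have hev := eval_topCompanion_eq_coeff (n := k + 3) (by omega) A₀ P₀ hP₀ N hN hNn A hAN c hc hdet (Bθ θ)
        (hBθaff θ) z₀ r
      rw [← hRz, ← hN₀r] at hev
      have hne : homogeneousComponent (N₀.rank * (k + 3))
          ((det ((Polynomial.X : Polynomial (MvPolynomial (Fin (k + 3) × Fin (k + 3)) ℂ)) •
            (Bθ θ).map Polynomial.C + A.map Polynomial.C)).coeff N₀.rank) ≠ 0 := by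
        intro h0
        rw [h0, map_zero] at hev
        exact hcoeff hev.symm
      rw [← hN₀r]
      by_contra hlt
      push Not at hlt
      refine hne (homogeneousComponent_eq_zero _ _ ?_)
      have hdeg := totalDegree_coeff_det_le A (Bθ θ) hA (hBθaff θ) N₀.rank
      rw [Fintype.card_fin] at hdeg
      omega
  -- Step 5: specialisation `θ → ∞`, i.e. `s = θ⁻¹ → 0`
  obtain ⟨θ₁, hθ₁⟩ := hSinf.nonempty
  have hrn : r * (k + 3) ≤ m := (hgood θ₁ hθ₁).2
  set S' : Set ℂ := (fun θ : ℂ => θ⁻¹) '' (S \ {0}) with hS'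
  have hS'inf : S'.Infinite :=
    (hSinf.sdiff (Set.finite_singleton 0)).image inv_injective.injOn
  set Mτ : Matrix (Fin (k + 3) × Fin (k + 3)) (Fin (k + 3) × Fin (k + 3)) (Polynomial ℂ) :=
    Hp.map Polynomial.C + (Polynomial.X : Polynomial ℂ) • Hq.map Polynomial.C with hMτ
  have hMτev : ∀ s : ℂ, Mτ.map (Polynomial.eval s) = Hp + s • Hq := by
    intro s
    apply Matrix.ext; intro a b
    simp only [hMτ, Matrix.map_apply, Matrix.add_apply, Matrix.smul_apply, smul_eq_mul, Polynomial.eval_add,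
      Polynomial.eval_C, Polynomial.eval_mul, Polynomial.eval_X]
  have hS'rank : ∀ s ∈ S', (Mτ.map (Polynomial.eval s)).rank ≤ r * (2 * m) := by
    rintro s ⟨θ, ⟨hθS, hθ0⟩, rfl⟩
    have hθ0' : θ ≠ 0 := hθ0
    have hsm : Hp + θ⁻¹ • Hq = θ⁻¹ • (θ • Hp + Hq) := by
      rw [smul_add, smul_smul, inv_mul_cancel₀ hθ0', one_smul]
    rw [hMτev, hsm, rank_smul_eq (inv_ne_zero hθ0')]
    exact (hgood θ hθS).1
  have hHp_le : Hp.rank ≤ r * (2 * m) := by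
    have h := rank_map_eval_le_of_infinite Mτ hS'inf hS'rank 0
    rwa [hMτev, zero_smul, add_zero] at h
  -- Step 6: Mignon–Ressayre point and arithmetic
  have hHpr : Hp.rank = (k + 3) ^ 2 := by
    rw [hHpdef, map_mul, transl_C, hess0_C_mul, rank_smul_eq (inv_ne_zero hβ)]
    exact rank_hess0_perPoly_eq_of_eval_det_ne_zero k z₀ hHz
  rw [hHpr] at hHp_le
  calc (k + 3) ^ 3 = (k + 3) * (k + 3) ^ 2 := by ring
    _ ≤ (k + 3) * (r * (2 * m)) := Nat.mul_le_mul_left _ hHp_le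
    _ = 2 * m * (r * (k + 3)) := by ring
    _ ≤ 2 * m * m := Nat.mul_le_mul_left _ hrn
    _ = 2 * m ^ 2 := by ring

end IndexThreeHalves

end Summit.ValiantsHypothesis.ValiantsHypothesis.Theorems.GrenetZeonTwoDimCoefficients.ScalingClosure

end
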